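import Summits.NavierStokesRegularity.NavierStokesRegularity.Theorems.AxisymmetricExtremalityAxisymmetricKatoGlobalStubSeregin2020TypeIILemma22EnergyAcrossAxis
import Literature.Analysis.FluidPDE.Seregin2020SwirlEnergyInequality
import HarnessLib

/-!
# Seregin 2020, Lemma 2.2 (after Nazarov–Uraltseva 2012): the ENERGY CLASS inequality (N–U (3.3)/(3.9) absorbed, `lintegral`
# dissipation, one space–time integral) ACROSS THE REGULAR AXIS, on an `S`-free slab — L22-B, second piece

Seat ns-es-p1 g3 (INPUTS lane A1, work package L22-B, KEY-NS #96; cut owner ns-inputs-plan g5; kit pub/ns-inputs/kits/A1-L22B.md).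

* `restrict_Icc_prod_univ_eq_restrict_Ioc_prod` — `vol|_{[t₁,t]×ℝ³} = vol|_{(t₁,t]} ⊗ vol` (the slice `{t₁} × ℝ³` is null).
* `energyClass_ineq_acrossAxis` — in the setting of `supersolution_energy_ineq_acrossAxis` (sibling `…Lemma22EnergyAcrossAxis`:
  slab `]lo,hi[ × O`, `O` open possibly meeting the axis, `Φ`, `∇Φ` continuous on the slab, the data off the axis, `∬|U|³ < ∞`,
  `Φ ≥ k` at the axis points, `Θ ∈ C¹_c(O)`, `η ∈ C¹`, `η ≥ 0`) and for `H ∈ C²` with `H' ≤ 0 ≤ H`, `H'' ≥ 0`, `H'² ≤ 2HH''`,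
  `H = 0` on `[k,∞)`: for `lo < t₁ ≤ t < hi`,
  `ofReal(η(t)M(t)) + ∫⁻_{[t₁,t]×ℝ³} ofReal(½ηH''(Φ)|∇Φ|²Θ²) ≤ ofReal(η(t₁)M(t₁) + ∬_{[t₁,t]×ℝ³}(4ηH(Φ)|∇Θ|² + ηH(Φ)⟪U,∇Θ²⟫
  + η(2/ϱ)H(Φ)∂_ϱΘ² + |η′|H(Φ)Θ²))` — EXACTLY the body of the FIXED `EnergyClass` text (pub/ns-inputs/kits/A1-sig-EnergyClass.md:
  the slice integral parenthesised, ONE space–time Bochner integral of the four-term sum) for this `(H, Θ, η, t₁, t)`.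
  Proof: the un-absorbed slice inequality, Fubini to one space–time integral, the POINTWISE absorption
  `−H′(Φ)⟪∇Φ,∇Θ²⟫ ≤ ½H″(Φ)|∇Φ|²Θ² + 4H(Φ)|∇Θ|²` (`Seregin2020.neg_cross_le_pointwise`), `η′M ≤ |η′|M`, and `ofReal` bookkeeping.

So `EnergyClass Φ U k R` holds for every `(Φ, U)` whose data on the slab `]−R²,0[ × B(0, 2R+δ)` are as above with NO singular set
there; the passage across a parabolic-null axis set `S` inside the slab is the remaining piece of L22-B (see the seat's note on
pub/ns-inputs/STATUS.md: finite parabolic covers, per-gap application of this theorem, spatial excision of the bad balls on the bad time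
intervals, errors `O(Σ rᵢ³)`).

WHAT THIS IS NOT: not yet `energyClass_acrossAxis_of_classV` (the `S`-passage), not Lemma 2.2, not NS regularity.  No summit
statement is proved here.  [NazarovUraltseva2012 §3 (3.3), (3.9), Remark 9; Seregin2020 §3 pp. 9–10]
-/

-- the problem directory repeats the summit name (D-0017); core's `dupNamespace` linter fires
set_option linter.dupNamespace false

noncomputable section

open MeasureTheory Set Function Filter Topology TopologicalSpace Metric WithLp intervalIntegral
open scoped NNReal ENNReal InnerProductSpace RealInnerProductSpace

namespace Summit.NavierStokesRegularity.NavierStokesRegularity.Theorems.AxisymmetricKatoGlobal.EulerScaling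

open Literature.Analysis.FluidPDE Literature.Analysis.FluidPDE.Seregin2020

/-- `vol|_{[t₁,t] × ℝ³} = vol|_{(t₁,t]} ⊗ vol` on `ℝ × ℝ³`: the slice `{t₁} × ℝ³` is Lebesgue-null. [folklore] -/
theorem restrict_Icc_prod_univ_eq_restrict_Ioc_prod (t₁ t : ℝ) :
    (volume : Measure (ℝ × EuclideanSpace ℝ (Fin 3))).restrict (Icc t₁ t ×ˢ (univ : Set (EuclideanSpace ℝ (Fin 3)))) =
      (volume.restrict (Ioc t₁ t)).prod (volume : Measure (EuclideanSpace ℝ (Fin 3))) := by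
  rw [restrict_Ioc_prod_volume_eq]
  refine Measure.restrict_congr_set ?_
  refine (ae_eq_set).2 ⟨?_, ?_⟩
  · have hsub : Icc t₁ t ×ˢ (univ : Set (EuclideanSpace ℝ (Fin 3))) \ Ioc t₁ t ×ˢ univ ⊆
        ({t₁} : Set ℝ) ×ˢ (univ : Set (EuclideanSpace ℝ (Fin 3))) := by
      rintro ⟨s, x⟩ ⟨⟨hs, -⟩, hns⟩
      refine ⟨?_, mem_univ _⟩
      have hs' : ¬ (t₁ < s ∧ s ≤ t) := fun h => hns ⟨h, mem_univ _⟩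
      have : s = t₁ := by
        by_contra hne
        exact hs' ⟨lt_of_le_of_ne hs.1 (Ne.symm hne), hs.2⟩
      exact this
    refine measure_mono_null hsub ?_
    rw [show (volume : Measure (ℝ × EuclideanSpace ℝ (Fin 3))) = (volume : Measure ℝ).prod volume from rfl,
      Measure.prod_prod, Real.volume_singleton, zero_mul]
  · have hsub : Ioc t₁ t ×ˢ (univ : Set (EuclideanSpace ℝ (Fin 3))) \ Icc t₁ t ×ˢ univ = ∅ :=
      Set.sdiff_eq_empty.2 (prod_mono Ioc_subset_Icc_self Subset.rfl)
    rw [hsub, measure_empty]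

/-- **The energy-class inequality across the regular axis on an `S`-free slab** (module docstring): the body of the FIXED
`EnergyClass` text for the given `H, Θ, η, t₁ ≤ t`, from `supersolution_energy_ineq_acrossAxis` by pointwise absorption of the cross
term and `lintegral` bookkeeping.  [cite: NazarovUraltseva2012, §3 (3.3), (3.9), Remark 9] -/
theorem energyClass_ineq_acrossAxis {O : Set (EuclideanSpace ℝ (Fin 3))} (hO : IsOpen O) {lo hi : ℝ}
    {Φ : ℝ → EuclideanSpace ℝ (Fin 3) → ℝ} {U : ℝ → EuclideanSpace ℝ (Fin 3) → EuclideanSpace ℝ (Fin 3)}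
    (hΦc : ContinuousOn (uncurry Φ) (Ioo lo hi ×ˢ O))
    (hΦg : ContinuousOn (fun z : ℝ × EuclideanSpace ℝ (Fin 3) => fderiv ℝ (Φ z.1) z.2) (Ioo lo hi ×ˢ O))
    (hΦs : ∀ z ∈ Ioo lo hi ×ˢ (O ∩ {x | cylRadius x ≠ 0}), ContDiffAt ℝ 2 (Φ z.1) z.2)
    (hΦt : ∀ z ∈ Ioo lo hi ×ˢ (O ∩ {x | cylRadius x ≠ 0}), DifferentiableAt ℝ (fun r => Φ r z.2) z.1)
    (hΦt' : ContinuousOn (fun z : ℝ × EuclideanSpace ℝ (Fin 3) => deriv (fun r => Φ r z.2) z.1)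
      (Ioo lo hi ×ˢ (O ∩ {x | cylRadius x ≠ 0})))
    (hUc : ContinuousOn (uncurry U) (Ioo lo hi ×ˢ (O ∩ {x | cylRadius x ≠ 0})))
    (hUs : ∀ z ∈ Ioo lo hi ×ˢ (O ∩ {x | cylRadius x ≠ 0}), ContDiffAt ℝ 1 (U z.1) z.2)
    (hdivU : ∀ z ∈ Ioo lo hi ×ˢ (O ∩ {x | cylRadius x ≠ 0}), VectorCalculus.divergence (U z.1) z.2 = 0)
    (hU3 : (∫⁻ z in Ioo lo hi ×ˢ O, ‖U z.1 z.2‖ₑ ^ (3 : ℕ)) < ⊤)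
    (hsup : ∀ z ∈ Ioo lo hi ×ˢ (O ∩ {x | cylRadius x ≠ 0}), 0 ≤ deriv (fun r => Φ r z.2) z.1 +
      fderiv ℝ (Φ z.1) z.2 (U z.1 z.2) + 2 / cylRadius z.2 * partialDeriv (eR z.2) (Φ z.1) z.2 -
      (Laplacian.laplacian (Φ z.1)) z.2)
    {k : ℝ} (hk : ∀ z ∈ Ioo lo hi ×ˢ O, cylRadius z.2 = 0 → k ≤ Φ z.1 z.2)
    {H : ℝ → ℝ} (hH : ContDiff ℝ 2 H) (hH' : ∀ v, deriv H v ≤ 0) (hH0 : ∀ v, 0 ≤ H v)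
    (hH2 : ∀ v, 0 ≤ deriv (deriv H) v) (hκ : ∀ v, deriv H v ^ 2 ≤ 2 * H v * deriv (deriv H) v)
    (hHk : ∀ v, k ≤ v → H v = 0)
    {Θ : EuclideanSpace ℝ (Fin 3) → ℝ} (hΘ : ContDiff ℝ 1 Θ) (hΘc : HasCompactSupport Θ) (hΘO : tsupport Θ ⊆ O)
    {η : ℝ → ℝ} (hη : ContDiff ℝ 1 η) (hη0 : ∀ s, 0 ≤ η s)
    {t₁ t : ℝ} (h1 : lo < t₁) (h1t : t₁ ≤ t) (ht : t < hi) :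
    ENNReal.ofReal (η t * ∫ x, H (Φ t x) * Θ x ^ 2) +
      ∫⁻ z in Icc t₁ t ×ˢ (univ : Set (EuclideanSpace ℝ (Fin 3))), ENNReal.ofReal
        (1 / 2 * η z.1 * (deriv (deriv H) (Φ z.1 z.2) * ‖gradient (Φ z.1) z.2‖ ^ 2 * Θ z.2 ^ 2))
    ≤ ENNReal.ofReal (η t₁ * (∫ x, H (Φ t₁ x) * Θ x ^ 2) +
        ∫ z in Icc t₁ t ×ˢ (univ : Set (EuclideanSpace ℝ (Fin 3))),
          (4 * η z.1 * (H (Φ z.1 z.2) * ‖gradient Θ z.2‖ ^ 2) +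
            η z.1 * (H (Φ z.1 z.2) * inner ℝ (U z.1 z.2) (gradient (fun y => Θ y ^ 2) z.2)) +
            η z.1 * (2 / cylRadius z.2 * (H (Φ z.1 z.2) * fderiv ℝ (fun y => Θ y ^ 2) z.2 (eR z.2))) +
            |deriv η z.1| * (H (Φ z.1 z.2) * Θ z.2 ^ 2))) := by
  -- ### the un-absorbed inequality and its one-integral form
  set μ : Measure (ℝ × EuclideanSpace ℝ (Fin 3)) := (volume.restrict (Ioc t₁ t)).prod volume with hμ
  set g₁ : ℝ × EuclideanSpace ℝ (Fin 3) → ℝ := fun z =>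
    deriv (deriv H) (Φ z.1 z.2) * ‖gradient (Φ z.1) z.2‖ ^ 2 * Θ z.2 ^ 2 with hg₁
  set g₂ : ℝ × EuclideanSpace ℝ (Fin 3) → ℝ := fun z =>
    deriv H (Φ z.1 z.2) * ⟪gradient (Φ z.1) z.2, gradient (fun y => Θ y ^ 2) z.2⟫ with hg₂
  set g₃ : ℝ × EuclideanSpace ℝ (Fin 3) → ℝ := fun z =>
    H (Φ z.1 z.2) * ⟪U z.1 z.2, gradient (fun y => Θ y ^ 2) z.2⟫ with hg₃
  set g₄ : ℝ × EuclideanSpace ℝ (Fin 3) → ℝ := fun z =>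
    2 / cylRadius z.2 * (H (Φ z.1 z.2) * fderiv ℝ (fun y => Θ y ^ 2) z.2 (eR z.2)) with hg₄
  set g₅ : ℝ × EuclideanSpace ℝ (Fin 3) → ℝ := fun z => H (Φ z.1 z.2) * Θ z.2 ^ 2 with hg₅
  set gP : ℝ × EuclideanSpace ℝ (Fin 3) → ℝ := fun z => H (Φ z.1 z.2) * ‖gradient Θ z.2‖ ^ 2 with hgP
  set F : ℝ × EuclideanSpace ℝ (Fin 3) → ℝ := fun z =>
    η z.1 * (-(g₁ z + g₂ z) + g₃ z + g₄ z) + deriv η z.1 * g₅ z with hFdef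
  set Rf : ℝ × EuclideanSpace ℝ (Fin 3) → ℝ := fun z =>
    4 * η z.1 * gP z + η z.1 * g₃ z + η z.1 * g₄ z + |deriv η z.1| * g₅ z with hRfdef
  obtain ⟨i₁, i₂, i₃, i₄, i₅⟩ := integrable_sliceIntegrands_acrossAxis hO hΦc hΦg hUc hU3 hH hΘ hΘc hΘO h1 ht
  have hFub := intervalIntegral_sliceFunctionals_eq_integral_prod hη h1t i₁ i₂ i₃ i₄ i₅
  have iF : Integrable F μ := hFub.1
  have hmain := supersolution_energy_ineq_acrossAxis O hO lo hi Φ U hΦc hΦg hΦs hΦt hΦt' hUc hUs hdivU hU3 hsup k hk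
    H hH hH' hHk Θ hΘ hΘc hΘO η hη hη0 t₁ t h1 h1t ht
    (fun s => ∫ x, H (Φ s x) * Θ x ^ 2)
    (fun s => ∫ x, deriv (deriv H) (Φ s x) * ‖gradient (Φ s) x‖ ^ 2 * Θ x ^ 2)
    (fun s => ∫ x, deriv H (Φ s x) * ⟪gradient (Φ s) x, gradient (fun y => Θ y ^ 2) x⟫)
    (fun s => ∫ x, H (Φ s x) * ⟪U s x, gradient (fun y => Θ y ^ 2) x⟫)
    (fun s => ∫ x, 2 / cylRadius x * (H (Φ s x) * fderiv ℝ (fun y => Θ y ^ 2) x (eR x)))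
    (fun _ => rfl) (fun _ => rfl) (fun _ => rfl) (fun _ => rfl) (fun _ => rfl)
  have hmain' : η t * (∫ x, H (Φ t x) * Θ x ^ 2) - η t₁ * (∫ x, H (Φ t₁ x) * Θ x ^ 2) ≤ ∫ z, F z ∂μ := by
    rw [← hFub.2]; exact hmain
  -- ### bounds on `η`, `η'`; integrability of the absorbed pieces
  obtain ⟨C, hC⟩ : ∃ C, ∀ s ∈ Icc t₁ t, ‖η s‖ ≤ C ∧ ‖deriv η s‖ ≤ C := by
    obtain ⟨C₁, hC₁⟩ := isCompact_Icc.exists_bound_of_continuousOn (hη.continuous.continuousOn (s := Icc t₁ t))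
    obtain ⟨C₂, hC₂⟩ := isCompact_Icc.exists_bound_of_continuousOn
      ((hη.continuous_deriv le_rfl).continuousOn (s := Icc t₁ t))
    exact ⟨max C₁ C₂, fun s hs => ⟨(hC₁ s hs).trans (le_max_left _ _), (hC₂ s hs).trans (le_max_right _ _)⟩⟩
  have hbη : ∀ᵐ z ∂μ, ‖η z.1‖ ≤ C := by
    filter_upwards [ae_fst_mem_Ioc t₁ t] with z hz using (hC z.1 (Ioc_subset_Icc_self hz)).1
  have hbη' : ∀ᵐ z ∂μ, ‖|deriv η z.1|‖ ≤ C := by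
    filter_upwards [ae_fst_mem_Ioc t₁ t] with z hz
    rw [Real.norm_eq_abs, abs_abs]
    exact (hC z.1 (Ioc_subset_Icc_self hz)).2
  have mη : AEStronglyMeasurable (fun z : ℝ × EuclideanSpace ℝ (Fin 3) => η z.1) μ :=
    (hη.continuous.comp continuous_fst).aestronglyMeasurable
  have mη' : AEStronglyMeasurable (fun z : ℝ × EuclideanSpace ℝ (Fin 3) => |deriv η z.1|) μ :=
    (((hη.continuous_deriv le_rfl).comp continuous_fst).abs).aestronglyMeasurable
  have hK : IsCompact (tsupport Θ) := hΘc
  have hgΘ0' : ∀ x, x ∉ tsupport Θ → gradient Θ x = 0 := fun x hx => gradient_eq_zero_of_notMem_tsupport hx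
  have iP : Integrable gP μ :=
    integrable_prod_of_continuousOn_of_eq_zero hK hΘO h1 ht
      ((hH.continuous.comp_continuousOn hΦc).mul
        (((continuous_gradient_of_contDiff hΘ).norm.pow 2).comp continuous_snd).continuousOn)
      (fun z hz => by simp [hgP, hgΘ0' z.2 hz])
  have iη₁ : Integrable (fun z => η z.1 * g₁ z) μ := i₁.bdd_mul mη hbη
  have iR : Integrable Rf μ :=
    ((((iP.bdd_mul mη hbη).const_mul 4).add (i₃.bdd_mul mη hbη)).add (i₄.bdd_mul mη hbη)).add
      (i₅.bdd_mul mη' hbη') |>.congr (ae_of_all _ fun z => by simp only [hRfdef, Pi.add_apply]; ring)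
  -- ### pointwise absorption
  have hpt : ∀ z, F z ≤ -(1 / 2) * (η z.1 * g₁ z) + Rf z := by
    intro z
    have hcross := neg_cross_le_pointwise hH0 hH2 hκ hΘ (Φ z.1) z.2
    have h1 : η z.1 * (-(g₂ z)) ≤ η z.1 * (g₁ z / 2 + 4 * gP z) := by
      refine mul_le_mul_of_nonneg_left ?_ (hη0 _)
      simpa only [hg₁, hg₂, hgP] using hcross
    have h5 : 0 ≤ g₅ z := mul_nonneg (hH0 _) (sq_nonneg _)
    have h2 : deriv η z.1 * g₅ z ≤ |deriv η z.1| * g₅ z := mul_le_mul_of_nonneg_right (le_abs_self _) h5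
    simp only [hFdef, hRfdef]
    nlinarith [h1, h2]
  have hint_le : ∫ z, F z ∂μ ≤ -(1 / 2) * (∫ z, η z.1 * g₁ z ∂μ) + ∫ z, Rf z ∂μ := by
    have iS : Integrable (fun z => -(1 / 2) * (η z.1 * g₁ z) + Rf z) μ := by
      exact (iη₁.const_mul _).add iR
    have h := integral_mono (g := fun z => -(1 / 2) * (η z.1 * g₁ z) + Rf z) iF iS hpt
    have e : ∫ z, (-(1 / 2) * (η z.1 * g₁ z) + Rf z) ∂μ = -(1 / 2) * (∫ z, η z.1 * g₁ z ∂μ) + ∫ z, Rf z ∂μ := by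
      rw [integral_add (iη₁.const_mul _) iR, MeasureTheory.integral_const_mul]
    exact h.trans_eq e
  -- ### nonnegativity of the pieces
  have hM0 : ∀ s, 0 ≤ ∫ x, H (Φ s x) * Θ x ^ 2 := fun s => integral_nonneg fun x => mul_nonneg (hH0 _) (sq_nonneg _)
  have hD0 : ∀ z, 0 ≤ η z.1 * g₁ z := fun z =>
    mul_nonneg (hη0 _) (mul_nonneg (mul_nonneg (hH2 _) (sq_nonneg _)) (sq_nonneg _))
  have hDint0 : 0 ≤ ∫ z, η z.1 * g₁ z ∂μ := integral_nonneg hD0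
  -- ### `ofReal` bookkeeping
  have hmeas : (volume : Measure (ℝ × EuclideanSpace ℝ (Fin 3))).restrict
      (Icc t₁ t ×ˢ (univ : Set (EuclideanSpace ℝ (Fin 3)))) = μ :=
    restrict_Icc_prod_univ_eq_restrict_Ioc_prod t₁ t
  have hdiss : ∫⁻ z in Icc t₁ t ×ˢ (univ : Set (EuclideanSpace ℝ (Fin 3))), ENNReal.ofReal
        (1 / 2 * η z.1 * (deriv (deriv H) (Φ z.1 z.2) * ‖gradient (Φ z.1) z.2‖ ^ 2 * Θ z.2 ^ 2)) =
      ENNReal.ofReal (1 / 2 * ∫ z, η z.1 * g₁ z ∂μ) := by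
    rw [hmeas, ← MeasureTheory.integral_const_mul,
      ofReal_integral_eq_lintegral_ofReal (iη₁.const_mul _)
        (ae_of_all _ fun z => mul_nonneg (by norm_num) (hD0 z))]
    refine lintegral_congr fun z => ?_
    simp only [hg₁]
    ring_nf
  have hRHS : ∫ z in Icc t₁ t ×ˢ (univ : Set (EuclideanSpace ℝ (Fin 3))),
      (4 * η z.1 * (H (Φ z.1 z.2) * ‖gradient Θ z.2‖ ^ 2) +
        η z.1 * (H (Φ z.1 z.2) * inner ℝ (U z.1 z.2) (gradient (fun y => Θ y ^ 2) z.2)) +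
        η z.1 * (2 / cylRadius z.2 * (H (Φ z.1 z.2) * fderiv ℝ (fun y => Θ y ^ 2) z.2 (eR z.2))) +
        |deriv η z.1| * (H (Φ z.1 z.2) * Θ z.2 ^ 2)) = ∫ z, Rf z ∂μ := by
    rw [hmeas]
  rw [hdiss, hRHS, ← ENNReal.ofReal_add (mul_nonneg (hη0 _) (hM0 _)) (by positivity)]
  refine ENNReal.ofReal_le_ofReal ?_
  linarith [hmain', hint_le]

end Summit.NavierStokesRegularity.NavierStokesRegularity.Theorems.AxisymmetricKatoGlobal.EulerScaling

end
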